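import Summits.BirchSwinnertonDyer.BirchSwinnertonDyer.Theorems.ResidualThetaTransportAtTwoSignedMuSeedAtTwoPlusTiltFormalGroup
import HarnessLib

/-!
# The WALL AT EVERY LEVEL (safe zone): closed form of the coefficients of `S_{m+1} = S_m + S_m(t ⊕ y_m)` below `t^{3N+v−3}`
# — seed line `jet-character-sums`, stubs J4/J5 (crux `SignedMuSeedAtTwoPlus` stmt-BirchSwinnertonDyer-21438; Kμ⁺ stmt-BirchSwinnertonDyer-20689;
# route `ResidualThetaTransportAtTwo`)

Cell `bsd-wall`, width seat `bsd-wall-rtt-p4-w2` g13 (`--supports`, closes nothing).  THEOREMS ONLY (no `def`, no named fact, no instance,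
no `sorry`); nothing about any curve, unit or `μ`-invariant is asserted; the line is NOT registered (W-79); BSD is not proved by this.

The card's J4 closed form `S₁ ≡ (ūT₄² + ū²T₆)t¹² (mod t¹⁴)` (kernel: `…JetLevelOneWall`, p678286) and its J5 caveat («a class with `E₀ ≡ 0` AND
`T₆ ≡ ū²T₄²` … then the closed forms stop at level 1») generalise: at EVERY level the step `S ↦ S + S(t + δ)` with `δ ≡ ū t^N (mod t^{2N})`
(`N = 4^{m+1}`) has, by the second-order Taylor formula and the characteristic-`2` square law `[tⁿ]S² = [2∣n]·([t^{n/2}]S)²`, the closed form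
`[t^e](S + S(t+δ)) = ū·[t^{e−N}](S²) + ū²·C(e−2N+2, 2)·[t^{e−2N+2}]S` for every `e` in the SAFE ZONE `2N ≤ e`, `e + 3 < 3N + v`, `e < 2N + 2v`
(`v ≤ ord S`; at a level where `NonDeg` failed, `v ≥ N − 2`, so the zone reaches `4N − 6`, three short of the next threshold `4N − 2`).

* §1 `coeff_mul_self_of_odd` / `coeff_mul_self_two_mul` — `[t^{2j+1}]S² = 0`, `[t^{2j}]S² = ([t^j]S)²` in characteristic `2`;
  `coeff_odd_of_riccati` — a Riccati series `S' = S²` has `U_{2j+1} = U_j²` for EVERY `j`.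
* §2 second-order Taylor with the sharp remainder: `le_order_binomialRemainder₂` (`ord((t+δ)^{m+2} − t^{m+2} − (m+2)t^{m+1}δ − C(m+2,2)t^mδ²) ≥ m + 3N − 1`),
  `hasseTwo_truncSum`, `truncSum_taylor₂`, **`le_order_taylorRemainder₂`** (`ord(f(t+δ) − f − f'δ − H₂f·δ²) ≥ 3N + v − 3`, `H₂f = Σ C(n,2)fₙ tⁿ⁻²`
  written as `PowerSeries.mk`).
* §3 **`coeff_levelStep_safeZone`** — the closed form above from `S' = S²` and `δ = ū t^N + t^{2N}ε`; **`coeff_levelStep_safeZone_even/odd`** —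
  with the square law: `[t^e] = ū·U_{(e−N)/2}² + ū²·C(e−2N+2,2)·U_{e−2N+2}` for `e − N` even, `ū²·C(e−2N+2,2)·U_{e−2N+2}` for `e − N` odd.
  (Level `1`: `N = 4`, `v = 4`, `e = 12` gives back `ūT₄² + 15ū²T₆`; level `2`: `N = 16`, `v = 14`, `e ∈ [32, 58]`: `[t⁴⁴]S₂ = ū₁U₁₄² + ū₁²U₁₄`,
  `[t⁴⁸]S₂ = ū₁U₁₆² + ū₁²U₁₈`, `[t⁵²]S₂ = ū₁U₁₈² + ū₁²U₂₂`, `[t⁵⁶]S₂ = ū₁U₂₀² + ū₁²U₂₆` — spelled out in the sequel `…JetLevelTwoWall`.)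

References: the card (J4, J5 «deep wall»); `Lines/norm-field-tilt.md` S2 (d); [SilvermanAEC2009] IV.1 for context only.
-/

set_option autoImplicit false
-- the Theorems namespace of this sub repeats the summit name by design (D-0017 nested layout)
set_option linter.dupNamespace false

noncomputable section

open PowerSeries Finset
open Summit.BirchSwinnertonDyer.BirchSwinnertonDyer.Theorems.SignedMuAtTwo.Tilt

namespace Summit.BirchSwinnertonDyer.BirchSwinnertonDyer.Theorems.SignedMuAtTwo.JetCharacterSums

variable {k : Type*} [CommRing k]

/-! ## §1 The square law in characteristic `2` -/

section SquareLaw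

variable [CharP k 2] (S : k⟦X⟧)

/-- `[t^{2j+1}](S·S) = 0` in characteristic `2` (the antidiagonal pairs off under `(i, j) ↦ (j, i)`). [folklore] -/
theorem coeff_mul_self_of_odd (j : ℕ) : coeff (2 * j + 1) (S * S) = 0 := by
  rw [coeff_mul]
  refine Finset.sum_involution (fun p _ => p.swap) (fun p hp => ?_) (fun p hp _ => ?_) (fun p hp => ?_) (fun p hp => ?_)
  · rw [Prod.fst_swap, Prod.snd_swap, mul_comm (coeff p.2 S), CharTwo.add_self_eq_zero]
  · intro h
    rw [HasAntidiagonal.mem_antidiagonal] at hp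
    have h1 : p.1 = p.2 := by simpa using (congrArg Prod.snd h)
    omega
  · rw [HasAntidiagonal.mem_antidiagonal] at hp ⊢
    rw [Prod.fst_swap, Prod.snd_swap]; omega
  · exact Prod.swap_swap p

/-- `[t^{2j}](S·S) = ([t^j]S)²` in characteristic `2`. [folklore] -/
theorem coeff_mul_self_two_mul (j : ℕ) : coeff (2 * j) (S * S) = coeff j S ^ 2 := by
  rw [coeff_mul]
  have hmem : (j, j) ∈ antidiagonal (2 * j) := by rw [HasAntidiagonal.mem_antidiagonal]; omega
  rw [← Finset.add_sum_erase _ _ hmem, sq]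
  suffices h : ∑ p ∈ (antidiagonal (2 * j)).erase (j, j), coeff p.1 S * coeff p.2 S = 0 by rw [h, add_zero]
  refine Finset.sum_involution (fun p _ => p.swap) (fun p hp => ?_) (fun p hp _ => ?_) (fun p hp => ?_) (fun p hp => ?_)
  · rw [Prod.fst_swap, Prod.snd_swap, mul_comm (coeff p.2 S), CharTwo.add_self_eq_zero]
  · intro h
    rw [mem_erase, HasAntidiagonal.mem_antidiagonal] at hp
    have h1 : p.1 = p.2 := by simpa using (congrArg Prod.snd h)
    apply hp.1
    ext <;> simp <;> omega
  · rw [mem_erase, HasAntidiagonal.mem_antidiagonal] at hp ⊢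
    refine ⟨fun h => hp.1 ?_, by rw [Prod.fst_swap, Prod.snd_swap]; omega⟩
    have := congrArg Prod.swap h
    rwa [Prod.swap_swap] at this
  · exact Prod.swap_swap p

/-- The square law with a parity test: `[tⁿ](S·S) = [2 ∣ n]·([t^{n/2}]S)²`. [folklore] -/
theorem coeff_mul_self_eq_ite (n : ℕ) : coeff n (S * S) = if Even n then coeff (n / 2) S ^ 2 else 0 := by
  rcases Nat.even_or_odd n with ⟨j, rfl⟩ | ⟨j, rfl⟩
  · rw [if_pos ⟨j, rfl⟩, ← two_mul, coeff_mul_self_two_mul, Nat.mul_div_cancel_left _ (by norm_num)]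
  · rw [if_neg (Nat.not_even_iff_odd.mpr ⟨j, rfl⟩), coeff_mul_self_of_odd]

/-- **In characteristic `2` a Riccati series `S' = S·S` has `[t^{2j+1}]S = ([t^j]S)²` for EVERY `j`** (`(2j+1)·U_{2j+1} = [t^{2j}](S·S)`).
[folklore] -/
theorem coeff_odd_of_riccati {S : k⟦X⟧} (hR : d⁄dX k S = S * S) (j : ℕ) : coeff (2 * j + 1) S = coeff j S ^ 2 := by
  have h := congrArg (coeff (2 * j)) hR
  rw [coeff_derivative, coeff_mul_self_two_mul] at h
  push_cast at h
  have h2k : (2 : k) = 0 := CharTwo.two_eq_zero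
  linear_combination h - (j : k) * coeff (2 * j + 1) S * h2k

end SquareLaw

/-! ## §2 Second-order Taylor expansion along `X ↦ X + δ` with the sharp remainder bound -/

section Taylor

/-- **Second-order binomial remainder.** `1 ≤ N ≤ ord δ` ⟹ `m + 3N − 1 ≤ ord((X+δ)^{m+2} − X^{m+2} − (m+2)X^{m+1}δ − C(m+2,2)X^mδ²)`,
by induction through `B_{m+3} = (X+δ)·B_{m+2} + C(m+2,2)·X^m·δ³`. [folklore] -/
theorem le_order_binomialRemainder₂ {δ : PowerSeries k} {N : ℕ} (hN : 1 ≤ N) (hδ : (N : ℕ∞) ≤ δ.order) (m : ℕ) :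
    ((m + 3 * N - 1 : ℕ) : ℕ∞) ≤
      ((X + δ) ^ (m + 2) - X ^ (m + 2) - ((m + 2 : ℕ) : PowerSeries k) * X ^ (m + 1) * δ -
        (((m + 2).choose 2 : ℕ) : PowerSeries k) * X ^ m * δ ^ 2).order := by
  induction m with
  | zero =>
    have : (X + δ) ^ (0 + 2) - X ^ (0 + 2) - ((0 + 2 : ℕ) : PowerSeries k) * X ^ (0 + 1) * δ -
        (((0 + 2).choose 2 : ℕ) : PowerSeries k) * X ^ 0 * δ ^ 2 = 0 := by
      norm_num; ring
    rw [this, order_zero]; exact le_top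
  | succ m ih =>
    have hch : ((m + 1 + 2).choose 2 : ℕ) = (m + 2).choose 2 + (m + 2) := by
      rw [show m + 1 + 2 = (m + 2) + 1 from rfl, Nat.choose_succ_succ, Nat.choose_one_right, add_comm]
    have key : (X + δ) ^ (m + 1 + 2) - X ^ (m + 1 + 2) - ((m + 1 + 2 : ℕ) : PowerSeries k) * X ^ (m + 1 + 1) * δ -
        (((m + 1 + 2).choose 2 : ℕ) : PowerSeries k) * X ^ (m + 1) * δ ^ 2
        = (X + δ) * ((X + δ) ^ (m + 2) - X ^ (m + 2) - ((m + 2 : ℕ) : PowerSeries k) * X ^ (m + 1) * δ -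
            (((m + 2).choose 2 : ℕ) : PowerSeries k) * X ^ m * δ ^ 2)
          + (((m + 2).choose 2 : ℕ) : PowerSeries k) * X ^ m * (δ * (δ * δ)) := by
      rw [hch]; push_cast; ring
    rw [key, show m + 1 + 3 * N - 1 = m + 3 * N by omega]
    have h1 : ((1 : ℕ) : ℕ∞) ≤ (X + δ).order :=
      le_order_add_of_le (by simpa using le_order_X_pow (k := k) 1) (le_trans (by exact_mod_cast hN) hδ)
    refine le_order_add_of_le ?_ ?_
    · have := le_order_mul_of_le h1 ih
      rwa [show 1 + (m + 3 * N - 1) = m + 3 * N by omega] at this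
    · have hc : ((0 : ℕ) : ℕ∞) ≤ ((((m + 2).choose 2 : ℕ) : PowerSeries k)).order := by simp
      have := le_order_mul_of_le (le_order_mul_of_le hc (le_order_X_pow (k := k) m))
        (le_order_mul_of_le hδ (le_order_mul_of_le hδ hδ))
      rwa [show 0 + m + (N + (N + N)) = m + 3 * N by omega] at this

/-- The second Hasse derivative `H₂f = Σₙ C(n+2,2)·f_{n+2}·tⁿ` (written as `PowerSeries.mk`) is additive. [folklore] -/
theorem hasseTwo_add (f g : PowerSeries k) :
    (PowerSeries.mk fun n => (((n + 2).choose 2 : ℕ) : k) * coeff (n + 2) (f + g)) =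
      (PowerSeries.mk fun n => (((n + 2).choose 2 : ℕ) : k) * coeff (n + 2) f) +
        PowerSeries.mk fun n => (((n + 2).choose 2 : ℕ) : k) * coeff (n + 2) g := by
  ext n; simp only [coeff_mk, map_add, mul_add]

/-- `H₂` of the truncation `f₀ + f₁t + Σ_{d<i} f_{d+2} t^{d+2}` is `Σ_{d<i} C(d+2,2) f_{d+2} t^d`. [folklore] -/
theorem hasseTwo_truncSum (f : PowerSeries k) (i : ℕ) :
    (PowerSeries.mk fun n => (((n + 2).choose 2 : ℕ) : k) *
        coeff (n + 2) (C (coeff 0 f) + C (coeff 1 f) * X + ∑ d ∈ range i, C (coeff (d + 2) f) * X ^ (d + 2))) =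
      ∑ d ∈ range i, C ((((d + 2).choose 2 : ℕ) : k) * coeff (d + 2) f) * X ^ d := by
  have hne : ∀ n : ℕ, n + 2 ≠ 1 := fun n => by omega
  ext n
  simp only [coeff_mk, map_add, map_sum, coeff_C_mul, coeff_X_pow, coeff_C, coeff_X, mul_ite, mul_one, mul_zero,
    Nat.succ_ne_zero, if_false, zero_add, hne, add_left_inj, Finset.sum_ite_eq, Finset.mem_range]

/-- The truncation differs from `f` in order `≥ i + 2`. [folklore] -/
theorem le_order_sub_truncSum₂ (f : PowerSeries k) (i : ℕ) :
    ((i + 2 : ℕ) : ℕ∞) ≤ (f - (C (coeff 0 f) + C (coeff 1 f) * X + ∑ d ∈ range i, C (coeff (d + 2) f) * X ^ (d + 2))).order := by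
  refine nat_le_order _ _ fun j hj => ?_
  simp only [map_sub, map_add, map_sum, coeff_C_mul, coeff_X_pow, coeff_C, coeff_X, mul_ite, mul_one, mul_zero]
  rcases j with _ | _ | j
  · simp
  · simp
  · have hne : j + 1 + 1 ≠ 1 := by omega
    simp only [Nat.succ_ne_zero, if_false, zero_add, hne, add_left_inj, Finset.sum_ite_eq, Finset.mem_range]
    rw [if_pos (by omega), sub_self]

/-- Exact second-order Taylor formula for the truncated sums:
`P(X+δ) − P − P'δ − H₂P·δ² = Σ_{d<i} f_{d+2}·B_{d+2}`, `B_{d+2} = (X+δ)^{d+2} − X^{d+2} − (d+2)X^{d+1}δ − C(d+2,2)X^dδ²`. [folklore] -/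
theorem truncSum_taylor₂ (f δ : PowerSeries k) (hδ : constantCoeff δ = 0) (i : ℕ) :
    (C (coeff 0 f) + C (coeff 1 f) * X + ∑ d ∈ range i, C (coeff (d + 2) f) * X ^ (d + 2)).subst (X + δ)
      - (C (coeff 0 f) + C (coeff 1 f) * X + ∑ d ∈ range i, C (coeff (d + 2) f) * X ^ (d + 2))
      - d⁄dX k (C (coeff 0 f) + C (coeff 1 f) * X + ∑ d ∈ range i, C (coeff (d + 2) f) * X ^ (d + 2)) * δ
      - (∑ d ∈ range i, C ((((d + 2).choose 2 : ℕ) : k) * coeff (d + 2) f) * X ^ d) * δ ^ 2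
    = ∑ d ∈ range i, C (coeff (d + 2) f) *
        ((X + δ) ^ (d + 2) - X ^ (d + 2) - ((d + 2 : ℕ) : PowerSeries k) * X ^ (d + 1) * δ -
          (((d + 2).choose 2 : ℕ) : PowerSeries k) * X ^ d * δ ^ 2) := by
  have hs : HasSubst (X + δ) := hasSubst_X_add hδ
  have hsub : (C (coeff 0 f) + C (coeff 1 f) * X + ∑ d ∈ range i, C (coeff (d + 2) f) * X ^ (d + 2)).subst (X + δ)
      = C (coeff 0 f) + C (coeff 1 f) * (X + δ) + ∑ d ∈ range i, C (coeff (d + 2) f) * (X + δ) ^ (d + 2) := by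
    rw [← coe_substAlgHom hs]
    simp only [map_add, map_sum, map_mul, map_pow, C_eq_algebraMap, AlgHom.commutes]
    rw [coe_substAlgHom hs, subst_X hs]
  have hder : d⁄dX k (C (coeff 0 f) + C (coeff 1 f) * X + ∑ d ∈ range i, C (coeff (d + 2) f) * X ^ (d + 2))
      = C (coeff 1 f) + ∑ d ∈ range i, C (coeff (d + 2) f) * (((d + 2 : ℕ) : PowerSeries k) * X ^ (d + 1)) := by
    simp only [map_add, map_sum, derivative_C, zero_add]
    rw [Derivation.leibniz, derivative_C, derivative_X, smul_zero, add_zero, smul_eq_mul, mul_one]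
    congr 1
    refine Finset.sum_congr rfl fun d _ => ?_
    rw [Derivation.leibniz, derivative_C, smul_zero, add_zero, smul_eq_mul, derivative_pow k, derivative_X,
      mul_one, show d + 2 - 1 = d + 1 from rfl]
  have hC : ∀ d : ℕ, C ((((d + 2).choose 2 : ℕ) : k) * coeff (d + 2) f) =
      C (coeff (d + 2) f) * (((d + 2).choose 2 : ℕ) : PowerSeries k) := by
    intro d; rw [map_mul, map_natCast, mul_comm]
  simp_rw [hC]
  rw [hsub, hder, add_mul, Finset.sum_mul, Finset.sum_mul]
  have : C (coeff 0 f) + C (coeff 1 f) * (X + δ) + ∑ d ∈ range i, C (coeff (d + 2) f) * (X + δ) ^ (d + 2)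
      - (C (coeff 0 f) + C (coeff 1 f) * X + ∑ d ∈ range i, C (coeff (d + 2) f) * X ^ (d + 2))
      - (C (coeff 1 f) * δ + ∑ d ∈ range i, C (coeff (d + 2) f) * (((d + 2 : ℕ) : PowerSeries k) * X ^ (d + 1)) * δ)
      - ∑ d ∈ range i, C (coeff (d + 2) f) * (((d + 2).choose 2 : ℕ) : PowerSeries k) * X ^ d * δ ^ 2
      = ∑ d ∈ range i, C (coeff (d + 2) f) * (X + δ) ^ (d + 2) - ∑ d ∈ range i, C (coeff (d + 2) f) * X ^ (d + 2)
        - ∑ d ∈ range i, C (coeff (d + 2) f) * (((d + 2 : ℕ) : PowerSeries k) * X ^ (d + 1)) * δ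
        - ∑ d ∈ range i, C (coeff (d + 2) f) * (((d + 2).choose 2 : ℕ) : PowerSeries k) * X ^ d * δ ^ 2 := by ring
  rw [this, ← Finset.sum_sub_distrib, ← Finset.sum_sub_distrib, ← Finset.sum_sub_distrib]
  exact Finset.sum_congr rfl fun d _ => by ring

/-- **Second-order Taylor bound.** For `f, δ ∈ k⟦X⟧` with `1 ≤ N ≤ ord δ` and `v ≤ ord f`:
`3N + v − 3 ≤ ord(f(X+δ) − f − f'·δ − H₂f·δ²)` with `H₂f = Σₙ C(n+2,2) f_{n+2} Xⁿ` the second Hasse derivative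
(the coefficient of `y²` in `f(t + y)`).  [folklore] -/
theorem le_order_taylorRemainder₂ {f δ : PowerSeries k} {N v : ℕ} (hN : 1 ≤ N) (hδ : (N : ℕ∞) ≤ δ.order)
    (hf : (v : ℕ∞) ≤ f.order) :
    ((3 * N + v - 3 : ℕ) : ℕ∞) ≤
      PowerSeries.order ((f.subst (X + δ) : PowerSeries k) - f - d⁄dX k f * δ -
        (PowerSeries.mk fun n => (((n + 2).choose 2 : ℕ) : k) * coeff (n + 2) f) * δ ^ 2) := by
  have hδ0 : constantCoeff δ = 0 := by
    have h0 := coeff_of_lt_order (φ := δ) 0 (lt_of_lt_of_le (by exact_mod_cast hN) hδ)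
    rwa [coeff_zero_eq_constantCoeff_apply] at h0
  have hs : HasSubst (X + δ) := hasSubst_X_add hδ0
  have hXδ : constantCoeff (X + δ) = 0 := by simp [hδ0]
  refine nat_le_order _ _ fun i hi => ?_
  -- split `f = P + g`, `P` the truncation to degrees `≤ i + 1`
  set P : PowerSeries k := C (coeff 0 f) + C (coeff 1 f) * X + ∑ d ∈ range i, C (coeff (d + 2) f) * X ^ (d + 2) with hP
  set g : PowerSeries k := f - P with hg
  have hgord : ((i + 2 : ℕ) : ℕ∞) ≤ g.order := le_order_sub_truncSum₂ f i
  have hH₂ : (PowerSeries.mk fun n => (((n + 2).choose 2 : ℕ) : k) * coeff (n + 2) f) =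
      (∑ d ∈ range i, C ((((d + 2).choose 2 : ℕ) : k) * coeff (d + 2) f) * X ^ d) +
        PowerSeries.mk fun n => (((n + 2).choose 2 : ℕ) : k) * coeff (n + 2) g := by
    have hfPg : f = P + g := by rw [hg]; ring
    conv_lhs => rw [hfPg]
    rw [hasseTwo_add, hP, hasseTwo_truncSum]
  have hsplit : (f.subst (X + δ) : PowerSeries k) - f - d⁄dX k f * δ -
      (PowerSeries.mk fun n => (((n + 2).choose 2 : ℕ) : k) * coeff (n + 2) f) * δ ^ 2
      = ((P.subst (X + δ) : PowerSeries k) - P - d⁄dX k P * δ -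
          (∑ d ∈ range i, C ((((d + 2).choose 2 : ℕ) : k) * coeff (d + 2) f) * X ^ d) * δ ^ 2)
        + ((g.subst (X + δ) : PowerSeries k) - g - d⁄dX k g * δ -
          (PowerSeries.mk fun n => (((n + 2).choose 2 : ℕ) : k) * coeff (n + 2) g) * δ ^ 2) := by
    have hfPg : f = P + g := by rw [hg]; ring
    have hsf : f.subst (X + δ) = P.subst (X + δ) + g.subst (X + δ) := by
      conv_lhs => rw [hfPg]
      rw [subst_add hs]
    have hdf : d⁄dX k f = d⁄dX k P + d⁄dX k g := by rw [← map_add, ← hfPg]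
    rw [hH₂, hsf, hdf]
    linear_combination (-1 : PowerSeries k) * hfPg
  rw [hsplit, map_add]
  -- the `P`-piece
  have hPpiece : ((3 * N + v - 3 : ℕ) : ℕ∞) ≤
      PowerSeries.order ((P.subst (X + δ) : PowerSeries k) - P - d⁄dX k P * δ -
        (∑ d ∈ range i, C ((((d + 2).choose 2 : ℕ) : k) * coeff (d + 2) f) * X ^ d) * δ ^ 2) := by
    rw [hP, truncSum_taylor₂ f δ hδ0 i]
    refine le_order_sum _ _ fun d _ => ?_
    by_cases hd : d + 2 < v
    · rw [coeff_of_lt_order (d + 2) (lt_of_lt_of_le (by exact_mod_cast hd) hf), map_zero, zero_mul, order_zero]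
      exact le_top
    · have hB := le_order_binomialRemainder₂ (k := k) hN hδ d
      have hc : ((0 : ℕ) : ℕ∞) ≤ (C (coeff (d + 2) f) : PowerSeries k).order := by simp
      refine le_trans ?_ (le_order_mul_of_le hc hB)
      exact_mod_cast (by omega)
  -- the `g`-piece: every summand has order `> i`
  have h1 : coeff i (g.subst (X + δ)) = 0 :=
    coeff_of_lt_order i (lt_of_lt_of_le (by exact_mod_cast (by omega : i < i + 2))
      (hgord.trans (le_order_subst_left' hXδ)))
  have h2 : coeff i g = 0 := coeff_of_lt_order i (lt_of_lt_of_le (by exact_mod_cast (by omega : i < i + 2)) hgord)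
  have h3 : coeff i (d⁄dX k g * δ) = 0 := by
    refine coeff_of_lt_order i (lt_of_lt_of_le ?_ (le_order_mul_of_le (le_order_derivative hgord) hδ))
    exact_mod_cast (by omega)
  have hH₂g : ((i : ℕ) : ℕ∞) ≤ (PowerSeries.mk fun n => (((n + 2).choose 2 : ℕ) : k) * coeff (n + 2) g).order := by
    refine nat_le_order _ _ fun j hj => ?_
    rw [coeff_mk, coeff_of_lt_order (j + 2) (lt_of_lt_of_le (by exact_mod_cast (by omega)) hgord), mul_zero]
  have h4 : coeff i ((PowerSeries.mk fun n => (((n + 2).choose 2 : ℕ) : k) * coeff (n + 2) g) * δ ^ 2) = 0 := by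
    refine coeff_of_lt_order i (lt_of_lt_of_le ?_ (le_order_mul_of_le hH₂g (le_order_mul_of_le hδ hδ |>.trans
      (by rw [sq]))))
    exact_mod_cast (by omega)
  rw [coeff_of_lt_order i (lt_of_lt_of_le (by exact_mod_cast hi) hPpiece), map_sub, map_sub, map_sub, h1, h2, h3, h4]
  simp

end Taylor

/-! ## §3 The wall at every level: the closed form in the safe zone -/

section Wall

variable [CharP k 2] {S δ ε : PowerSeries k} {u : k} {N v e : ℕ}

include S δ ε u N v e in
/-- **The wall, general level (safe zone).**  `S' = S·S`, `v ≤ ord S`, `δ = ū t^N + t^{2N}ε`, `1 ≤ N`; then for every `e` with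
`2N ≤ e`, `e + 3 < 3N + v` and `e < 2N + 2v`:
`[t^e](S + S(t+δ)) = ū·[t^{e−N}](S·S) + ū²·C(e−2N+2, 2)·[t^{e−2N+2}]S`. [folklore] -/
theorem coeff_levelStep_safeZone (hN : 1 ≤ N) (hR : d⁄dX k S = S * S) (hv : (v : ℕ∞) ≤ S.order)
    (hδ : δ = C u * X ^ N + X ^ (2 * N) * ε) (h2N : 2 * N ≤ e) (h1 : e + 3 < 3 * N + v) (h2 : e < 2 * N + 2 * v) :
    coeff e (S + S.subst (X + δ)) =
      u * coeff (e - N) (S * S) + u ^ 2 * ((((e - 2 * N + 2).choose 2 : ℕ) : k) * coeff (e - 2 * N + 2) S) := by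
  have hδord : (N : ℕ∞) ≤ δ.order := by
    rw [hδ]
    refine le_order_add_of_le ?_ ?_
    · have := le_order_mul_of_le (show ((0 : ℕ) : ℕ∞) ≤ (C u : PowerSeries k).order by simp) (le_order_X_pow (k := k) N)
      simpa using this
    · have := le_order_mul_of_le (le_order_X_pow (k := k) (2 * N)) (show ((0 : ℕ) : ℕ∞) ≤ ε.order by simp)
      exact le_trans (by exact_mod_cast (by omega)) this
  have hT := le_order_taylorRemainder₂ hN hδord hv
  set R : PowerSeries k := S.subst (X + δ) - S - d⁄dX k S * δ -
    (PowerSeries.mk fun n => (((n + 2).choose 2 : ℕ) : k) * coeff (n + 2) S) * δ ^ 2 with hRdef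
  -- `S + S(X+δ) = S'δ + H₂S·δ² + R` (characteristic 2: `S + S = 0`)
  have hsum : S + S.subst (X + δ) = S * S * δ +
      (PowerSeries.mk fun n => (((n + 2).choose 2 : ℕ) : k) * coeff (n + 2) S) * δ ^ 2 + R := by
    rw [hRdef, ← hR]; linear_combination Tilt.add_self_eq_zero S
  -- `δ = ū t^N + t^{2N}ε`, `δ² = ū² t^{2N} + t^{4N} ε²`
  have hδsq : δ ^ 2 = C u ^ 2 * X ^ (2 * N) + X ^ (4 * N) * ε ^ 2 := by
    rw [hδ, show 4 * N = 2 * (2 * N) from by ring, pow_mul, pow_mul]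
    linear_combination (C u * X ^ N * (X ^ (2 * N) * ε)) * two_eq_zero_powerSeries (k := k)
  rw [hsum, hδsq, hδ, map_add, map_add]
  -- term by term
  have hSS : ((2 * v : ℕ) : ℕ∞) ≤ (S * S).order := by
    have := le_order_mul_of_le hv hv; rwa [show v + v = 2 * v by ring] at this
  have hA : coeff e (S * S * (C u * X ^ N + X ^ (2 * N) * ε)) = u * coeff (e - N) (S * S) := by
    rw [mul_add, map_add, show S * S * (C u * X ^ N) = C u * (X ^ N * (S * S)) by ring, coeff_C_mul, coeff_X_pow_mul',
      if_pos (by omega), show S * S * (X ^ (2 * N) * ε) = X ^ (2 * N) * (S * S * ε) by ring, coeff_X_pow_mul', if_pos h2N]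
    have hz : coeff (e - 2 * N) (S * S * ε) = 0 :=
      coeff_of_lt_order _ (lt_of_lt_of_le (by exact_mod_cast (by omega))
        (le_order_mul_of_le hSS (show ((0 : ℕ) : ℕ∞) ≤ ε.order by simp)))
    rw [hz, add_zero]
  have hHord : (((v - 2 : ℕ)) : ℕ∞) ≤ (PowerSeries.mk fun n => (((n + 2).choose 2 : ℕ) : k) * coeff (n + 2) S).order := by
    refine nat_le_order _ _ fun j hj => ?_
    rw [coeff_mk, coeff_of_lt_order (j + 2) (lt_of_lt_of_le (by exact_mod_cast (by omega)) hv), mul_zero]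
  have hB : coeff e ((PowerSeries.mk fun n => (((n + 2).choose 2 : ℕ) : k) * coeff (n + 2) S) *
      (C u ^ 2 * X ^ (2 * N) + X ^ (4 * N) * ε ^ 2)) =
      u ^ 2 * ((((e - 2 * N + 2).choose 2 : ℕ) : k) * coeff (e - 2 * N + 2) S) := by
    rw [mul_add, map_add, ← map_pow,
      show (PowerSeries.mk fun n => (((n + 2).choose 2 : ℕ) : k) * coeff (n + 2) S) * (C (u ^ 2) * X ^ (2 * N)) =
        C (u ^ 2) * (X ^ (2 * N) * PowerSeries.mk fun n => (((n + 2).choose 2 : ℕ) : k) * coeff (n + 2) S) by ring,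
      coeff_C_mul, coeff_X_pow_mul', if_pos h2N, coeff_mk, show e - 2 * N + 2 = e - 2 * N + 2 from rfl,
      show (PowerSeries.mk fun n => (((n + 2).choose 2 : ℕ) : k) * coeff (n + 2) S) * (X ^ (4 * N) * ε ^ 2) =
        X ^ (4 * N) * ((PowerSeries.mk fun n => (((n + 2).choose 2 : ℕ) : k) * coeff (n + 2) S) * ε ^ 2) by ring,
      coeff_X_pow_mul']
    split_ifs with h4N
    · rw [coeff_of_lt_order _ (lt_of_lt_of_le (by exact_mod_cast (by omega))
        (le_order_mul_of_le hHord (show ((0 : ℕ) : ℕ∞) ≤ (ε ^ 2).order by simp))), add_zero]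
    · rw [add_zero]
  have hlt : ((e : ℕ) : ℕ∞) < ((3 * N + v - 3 : ℕ) : ℕ∞) := by exact_mod_cast (by omega)
  have hC : coeff e R = 0 := coeff_of_lt_order _ (lt_of_lt_of_le hlt hT)
  rw [hA, hB, hC, add_zero]

/-- **The wall, `e − N` even:** `[t^e](S + S(t+δ)) = ū·U_{(e−N)/2}² + ū²·C(e−2N+2,2)·U_{e−2N+2}` (`Uₙ = [tⁿ]S`). [folklore] -/
theorem coeff_levelStep_safeZone_even (hN : 1 ≤ N) (hR : d⁄dX k S = S * S) (hv : (v : ℕ∞) ≤ S.order)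
    (hδ : δ = C u * X ^ N + X ^ (2 * N) * ε) (h2N : 2 * N ≤ e) (h1 : e + 3 < 3 * N + v) (h2 : e < 2 * N + 2 * v)
    (he : Even (e - N)) :
    coeff e (S + S.subst (X + δ)) =
      u * coeff ((e - N) / 2) S ^ 2 + u ^ 2 * ((((e - 2 * N + 2).choose 2 : ℕ) : k) * coeff (e - 2 * N + 2) S) := by
  rw [coeff_levelStep_safeZone hN hR hv hδ h2N h1 h2, coeff_mul_self_eq_ite, if_pos he]

/-- **The wall, `e − N` odd:** `[t^e](S + S(t+δ)) = ū²·C(e−2N+2,2)·U_{e−2N+2}`. [folklore] -/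
theorem coeff_levelStep_safeZone_odd (hN : 1 ≤ N) (hR : d⁄dX k S = S * S) (hv : (v : ℕ∞) ≤ S.order)
    (hδ : δ = C u * X ^ N + X ^ (2 * N) * ε) (h2N : 2 * N ≤ e) (h1 : e + 3 < 3 * N + v) (h2 : e < 2 * N + 2 * v)
    (he : ¬ Even (e - N)) :
    coeff e (S + S.subst (X + δ)) = u ^ 2 * ((((e - 2 * N + 2).choose 2 : ℕ) : k) * coeff (e - 2 * N + 2) S) := by
  rw [coeff_levelStep_safeZone hN hR hv hδ h2N h1 h2, coeff_mul_self_eq_ite, if_neg he, mul_zero, zero_add]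

/-- Below `2N` (and below the Taylor bound) every coefficient of `S + S(t+δ)` vanishes when `2N ≤ 2v + N`... stated simply:
for `e < 2N` with `e + 3 < 3N + v` and `e < N + 2v`, `[t^e](S + S(t+δ)) = 0`. [folklore] -/
theorem coeff_levelStep_eq_zero_of_lt (hN : 1 ≤ N) (hR : d⁄dX k S = S * S) (hv : (v : ℕ∞) ≤ S.order)
    (hδ : δ = C u * X ^ N + X ^ (2 * N) * ε) (he : e < 2 * N) (h1 : e + 3 < 3 * N + v) (h2 : e < N + 2 * v) :
    coeff e (S + S.subst (X + δ)) = 0 := by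
  have hδord : (N : ℕ∞) ≤ δ.order := by
    rw [hδ]
    refine le_order_add_of_le ?_ ?_
    · have := le_order_mul_of_le (show ((0 : ℕ) : ℕ∞) ≤ (C u : PowerSeries k).order by simp) (le_order_X_pow (k := k) N)
      simpa using this
    · have := le_order_mul_of_le (le_order_X_pow (k := k) (2 * N)) (show ((0 : ℕ) : ℕ∞) ≤ ε.order by simp)
      exact le_trans (by exact_mod_cast (by omega)) this
  have hT := le_order_taylorRemainder₂ hN hδord hv
  have hsum : S + S.subst (X + δ) = S * S * δ +
      (PowerSeries.mk fun n => (((n + 2).choose 2 : ℕ) : k) * coeff (n + 2) S) * δ ^ 2 +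
      (S.subst (X + δ) - S - d⁄dX k S * δ -
        (PowerSeries.mk fun n => (((n + 2).choose 2 : ℕ) : k) * coeff (n + 2) S) * δ ^ 2) := by
    rw [← hR]; linear_combination Tilt.add_self_eq_zero S
  have hSS : ((2 * v : ℕ) : ℕ∞) ≤ (S * S).order := by
    have := le_order_mul_of_le hv hv; rwa [show v + v = 2 * v by ring] at this
  have hHord : (((v - 2 : ℕ)) : ℕ∞) ≤ (PowerSeries.mk fun n => (((n + 2).choose 2 : ℕ) : k) * coeff (n + 2) S).order := by
    refine nat_le_order _ _ fun j hj => ?_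
    rw [coeff_mk, coeff_of_lt_order (j + 2) (lt_of_lt_of_le (by exact_mod_cast (by omega)) hv), mul_zero]
  rw [hsum, map_add, map_add,
    coeff_of_lt_order e (lt_of_lt_of_le (by exact_mod_cast (by omega)) (le_order_mul_of_le hSS hδord)),
    coeff_of_lt_order e (lt_of_lt_of_le (by exact_mod_cast (by omega))
      (le_order_mul_of_le hHord ((le_order_mul_of_le hδord hδord).trans (by rw [sq])))),
    coeff_of_lt_order e (lt_of_lt_of_le (by exact_mod_cast (by omega)) hT)]
  simp

end Wall

end Summit.BirchSwinnertonDyer.BirchSwinnertonDyer.Theorems.SignedMuAtTwo.JetCharacterSums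

end
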